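import Mathlib
import Summits.ResolutionOfSingularities.ResolutionOfSingularities.Theorems.RadicialJungCleanModelsCleanProp44BirthCount
import Summits.ResolutionOfSingularities.ResolutionOfSingularities.Theorems.RadicialJungCleanModelsCleanProp44BirthOrder
import HarnessLib

/-!
# Route `RadicialJung`, crux `CleanModels` (stmt-ResolutionOfSingularities-15917), line `Sketch` rev 35, stub 6 `stub_cleanProp44` (X44c):
# THE BIRTH COUNT ALONG A RESTRICTION MAP — `Σ_i (ν_i − 1)·[κ(c′_i):κ] ≤ deg D(U|_ℓ)` for birth orders measured UPSTAIRS

Seat decomp-res-hand-2 g20 (structural hand); capstone of ✓ `…CleanProp44BirthCount.lean` (the count on `𝔸¹_κ`) and ✓ `…CleanProp44BirthOrder.lean` (the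
higher-order test, transport, denominators).  The termination author measures the birth order of the tracked unit `U` UPSTAIRS, in the ring `O` of a chart
of the blown-up threefold (or, with denominators, in its local rings — ✓ `exists_sub_pow_mem_sup_pow_of_localization` pulls that back to `O` at closed
points): «`ν_i ≥ e_i + 1` at the point `q_i`» is `∃ c_i, U − c_i^p ∈ K + q_i^{e_i+1}` (`K` the ideal of the line `ℓ`).  Given the RESTRICTION TO THE LINE
`φ : O → κ[w]` (`φ K = 0`, `φ q_i ⊆ (P_i)`, `P_i` pairwise distinct primes = the closed points `c′_i` of `ℓ ≅ 𝔸¹_κ`) and any derivation `D` of `κ[w]` with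
`D(φ U) ≠ 0`:

* `sub_pow_mem_span_pow_of_sub_pow_mem` — transport of one birth order: `U − c^p ∈ K + q^{e+1}` ⟹ `φU·1^p + (−φc)^p ∈ (P)^{e+1}`.
* `sum_mul_natDegree_le_of_sub_pow_mem` — **THE COUNT UPSTAIRS**: `Σ_i e_i · deg P_i ≤ deg D(φ U)`; with denominators (`q_i` maximal, `c′_i` in the local
  rings): `sum_mul_natDegree_le_of_sub_pow_mem_localization`.

So along a created line the obstruction points with unit representative (✓ `two_le_birthOrder_of_not_cleanPermissibleAt`: `ν ≥ 2`) are finitely many, of total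
weight `Σ(ν − 1)[κ(c′):κ] ≤ deg D(U|_ℓ)` — memo 4e §2.6 (c), every residue field.  Honest framing: OURS, assembly; the link `δ* ≤ ν` and the degree bound
`deg(U|_{Γ″}) ≤ δ` (memo §2.5) are NOT typed; nothing here proves X44c, any case of `CleanModels`, or resolution of singularities in characteristic `p`.
[cite: CossartPiltant2009, ch.1 II.5.3.2 (i)] [cite: CossartPiltant2008, Prop. 4.4 (proof, p. 11)]
-/

noncomputable section

set_option linter.dupNamespace false -- mandated namespace of this single-conjunct summit

open Polynomial

namespace Summit.ResolutionOfSingularities.ResolutionOfSingularities.Theorems.RadicialJung.CleanModels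

variable {O : Type*} [CommRing O] {k : Type*} [Field k] (p : ℕ) [hp : Fact p.Prime] [CharP k p] (φ : O →+* k[X]) (K : Ideal O)

/-- In characteristic `p`: `F − G^p = F·1^p + (−G)^p`. [folklore] -/
theorem sub_pow_eq_mul_one_pow_add_neg_pow (F G : k[X]) : F - G ^ p = F * 1 ^ p + (-G) ^ p := by
  rw [one_pow, mul_one]
  rcases hp.out.eq_two_or_odd' with rfl | hodd
  · rw [neg_sq, CharTwo.sub_eq_add]
  · rw [hodd.neg_pow, sub_eq_add_neg]

/-- **Transport of one birth order to the line**: `φ K = 0`, `φ q ⊆ (P)`, `U − c^p ∈ K + q^{e+1}` ⟹ `φU·1^p + (−φc)^p ∈ (P)^{e+1}`.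
[cite: CossartPiltant2009, ch.1 II.5.3.2 (i)] -/
theorem sub_pow_mem_span_pow_of_sub_pow_mem (hK : ∀ x ∈ K, φ x = 0) {q : Ideal O} {P : k[X]} (hqP : ∀ x ∈ q, φ x ∈ Ideal.span {P})
    {U c : O} {e : ℕ} (h : U - c ^ p ∈ K ⊔ q ^ (e + 1)) :
    φ U * 1 ^ p + (-φ c) ^ p ∈ Ideal.span {P} ^ (e + 1) := by
  have h1 := map_mem_sup_pow_of_mem_sup_pow φ K q (⊥ : Ideal k[X]) (Ideal.span {P})
    (fun x hx => by rw [hK x hx]; exact zero_mem _) hqP h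
  rw [bot_sup_eq, map_sub, map_pow] at h1
  rwa [← sub_pow_eq_mul_one_pow_add_neg_pow p]

/-- **THE BIRTH COUNT UPSTAIRS.**  `φ : O → κ[w]` with `φ K = 0`; distinct closed points `(P_i)` of the line (`P_i` prime, pairwise non-dividing) under
ideals `q_i ⊆ O` (`φ q_i ⊆ (P_i)`); birth orders measured in `O`: `U − c_i^p ∈ K + q_i^{e_i+1}`; a derivation `D` of `κ[w]` with `D(φ U) ≠ 0`.  Then
`Σ_i e_i · deg P_i ≤ deg D(φ U)`. [cite: CossartPiltant2009, ch.1 II.5.3.2 (i)] [cite: CossartPiltant2008, Prop. 4.4 (proof, p. 11)] -/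
theorem sum_mul_natDegree_le_of_sub_pow_mem (hK : ∀ x ∈ K, φ x = 0) {R : Type*} [CommRing R] [Algebra R k[X]]
    (D : Derivation R k[X] k[X]) {U : O} (hDF : D (φ U) ≠ 0) {ι : Type*} (s : Finset ι) (q : ι → Ideal O) (P : ι → k[X]) (e : ι → ℕ)
    (hP : ∀ i ∈ s, Prime (P i)) (hne : ∀ i ∈ s, ∀ j ∈ s, i ≠ j → ¬ P i ∣ P j) (hqP : ∀ i ∈ s, ∀ x ∈ q i, φ x ∈ Ideal.span {P i})
    (h : ∀ i ∈ s, ∃ c : O, U - c ^ p ∈ K ⊔ q i ^ (e i + 1)) :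
    ∑ i ∈ s, e i * (P i).natDegree ≤ (D (φ U)).natDegree := by
  classical
  choose! c hc using h
  refine sum_mul_natDegree_le_of_add_pow_mem p D hDF s P (fun _ => 1) (fun i => -φ (c i)) e hP hne
    (fun i hi h1 => (hP i hi).not_unit (isUnit_of_dvd_one h1)) fun i hi => ?_
  exact sub_pow_mem_span_pow_of_sub_pow_mem p φ K hK (hqP i hi) (hc i hi)

/-- **The same with denominators**: the `q_i` MAXIMAL, the birth orders measured in the local rings `O_i` of the closed points (`c′_i ∈ O_i`,
`U − c′_i^p ∈ K O_i + (q_i O_i)^{e_i+1}`) — pulled back to `O` by ✓ `exists_sub_pow_mem_sup_pow_of_localization`. [cite: CossartPiltant2009, ch.1 II.5.3.2 (i)] -/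
theorem sum_mul_natDegree_le_of_sub_pow_mem_localization (hK : ∀ x ∈ K, φ x = 0) {R : Type*} [CommRing R] [Algebra R k[X]]
    (D : Derivation R k[X] k[X]) {U : O} (hDF : D (φ U) ≠ 0) {ι : Type*} (s : Finset ι) (q : ι → Ideal O) (hq : ∀ i ∈ s, (q i).IsMaximal)
    (P : ι → k[X]) (e : ι → ℕ)
    (hP : ∀ i ∈ s, Prime (P i)) (hne : ∀ i ∈ s, ∀ j ∈ s, i ≠ j → ¬ P i ∣ P j) (hqP : ∀ i ∈ s, ∀ x ∈ q i, φ x ∈ Ideal.span {P i})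
    (Oi : ι → Type*) [∀ i, CommRing (Oi i)] [∀ i, Algebra O (Oi i)] [∀ i, CharP (Oi i) p]
    (hloc : ∀ i ∈ s, ∀ _ : (q i).IsMaximal, IsLocalization.AtPrime (Oi i) (q i))
    (h : ∀ i ∈ s, ∃ c' : Oi i, algebraMap O (Oi i) U - c' ^ p ∈ K.map (algebraMap O (Oi i)) ⊔ ((q i).map (algebraMap O (Oi i))) ^ (e i + 1)) :
    ∑ i ∈ s, e i * (P i).natDegree ≤ (D (φ U)).natDegree := by
  refine sum_mul_natDegree_le_of_sub_pow_mem p φ K hK D hDF s q P e hP hne hqP fun i hi => ?_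
  haveI := hq i hi
  haveI := hloc i hi (hq i hi)
  obtain ⟨c', hc'⟩ := h i hi
  exact exists_sub_pow_mem_sup_pow_of_localization (q i) p K (e i) hc'

end Summit.ResolutionOfSingularities.ResolutionOfSingularities.Theorems.RadicialJung.CleanModels

end
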